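import Summits.BirchSwinnertonDyer.BirchSwinnertonDyer.Theses.GenusKolyvaginAtTwo
import Summits.BirchSwinnertonDyer.BirchSwinnertonDyer.Theorems.CMKolyvaginAtInertTwoRestrictionInjectiveAtTwo
import Literature.NumberTheory.EllipticCurves.HeegnerPointsKolyvaginExceptionalSelmerProofs
import Literature.NumberTheory.EllipticCurves.BSDRankZeroDensity

/-!
# Route `GenusKolyvaginAtTwo`, LINE 6: Q5 `EquivariantChebotarevAtTwo` AS TYPED is FALSE modulo the
# `𝔽₄`-structure of `H¹(K, E[2])` at the discriminant field `K = ℚ(√Δ_E)` — NEGATIVE LEMMA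
# (seat gk2-p2 g6; `--negative-modulo DiscFieldFourStructureAtTwo`)

Item stmt-BirchSwinnertonDyer-24881 (Q5) quantifies over ALL imaginary quadratic `K`; the parent
crux 22137 excludes `K = ℚ(√Δ_E)` (`¬ IsSquare (d_K · (−|Δ|))`). WITH that binder Q5 is proved
(`GenusExact.equivariantChebotarevAtTwo_of_not_isSquare`, p606279). WITHOUT it, at `K = ℚ(√Δ_E)`:
`ρ̄_{E,2}(Γ_K) = A₃ = ⟨z⟩` (even permutations fix `√Δ = ∏(eᵢ − eⱼ)`), so `ω := (z • ·)` is a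
`Γ_K`-equivariant automorphism of `E[2]` with `ω² + ω + 1 = 0`, `E[2]` is an `𝔽₄ = 𝔽₂[ω]`-line, and by
functoriality of `H¹(Γ_K, ·)` in the coefficients `𝓗 := H¹(K, E[2])` is an `𝔽₄`-vector space on which
(i) every local kernel `ker (H¹(K, E[2]) → H¹(K_v, E[2]))` is an `𝔽₄`-subspace, (ii) complex
conjugation acts `ω`-SEMILINEARLY (`(ωy)^τ = ω² y^τ`, as `τ z τ⁻¹ = z⁻¹`), (iii) `dim_{𝔽₄} 𝓗 = ∞`
(inflation–restriction: `𝓗 ≅ ((L^×/L^{×2}) ⊗ E[2])^{A₃}`, `L = K(E[2])`, and every prime of `K` split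
in `L` contributes a free `𝔽₂[A₃]`-line), so some `x ∈ 𝓗` has `x, x^τ` `𝔽₄`-independent (semilinear
descent: `𝓗 = 𝓗^τ ⊗_{𝔽₂} 𝔽₄`, take `x = u + ωv` with `u, v ∈ 𝓗^τ` independent). This structure is the
hypothesis `DiscFieldFourStructureAtTwo` below (a CONSTRUCTION the tree cannot yet perform: it lacks
the coefficient-functoriality of `galH1Torsion` and any supply of classes); a witness in nature is
`E : y² = x³ + x + 1` (`Δ = −496`, `j = 6912/31`, no CM, `ρ_{E,2^∞}` onto by Dokchitser–Dokchitser
(1)–(3) + the mod-`8` lift: the `2`-division cubic is irreducible, `±Δ, ±2Δ ∉ ℚ^{×2}`,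
`31t⁴ + 248t³ + 1728` has no rational root), `K = ℚ(√−31)` (`d_K = −31` odd, `d_K·Δ = 124²`).

GIVEN the structure, the `τ`-STABLE family `(c₀, c₁, c₂) = (ωx + ω²x^τ, x, x^τ)` with `π = (1 2)`
satisfies every hypothesis of Q5 at `M = 1` (non-zero; `c_* c_i = c_{π i}`; `ℤ`-independent — it is
`𝔽₄`-DEPENDENT but the only `𝔽₂`-relation is trivial; restriction-injective by the tree's
`KolyvaginImageTwo.h1_restriction_injective_two`; orders `2`), the prescription `N = (1, 0, 0)` is
admissible (`N ≤ 1`, constant on `π`-orbits), and its prime set is EMPTY: at the place `λ ∋ ℓ`,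
`c₁, c₂ ∈ ker loc_λ` forces `c₀ = ωc₁ + ω²c₂ ∈ ker loc_λ` by (i). Hence `¬ EquivariantChebotarevAtTwo`.

HONEST FRAMING. Negative lemma `H → ¬Q5` (item 24881 stays open / held; `H` is filed as a
construction item); the repaired statement is PROVED (p606279). BSD is not proved by any of this.

References: [McCallumLMS1991] §3 Cor. 3.2; [GrossLMS1991] §9 (the standing hypothesis
`K ⊄ ℚ(E_p)`); [Kolyvagin1989] Thm. B (exclusion `K ≠ ℚ(√−|Δ|)`); [LawsonWuthrich2016] Lemma 6;
[DokchitserDokchitserMathZ2012] Thm.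
-/

set_option autoImplicit false
set_option linter.dupNamespace false

noncomputable section

open scoped Classical

namespace Summit.BirchSwinnertonDyer.BirchSwinnertonDyer.Theorems.GenusExact

open WeierstrassCurve NumberField IsDedekindDomain Field Finset
open Literature.NumberTheory.GaloisRepresentations Literature.NumberTheory.EllipticCurves
open Literature.NumberTheory
open Summit.BirchSwinnertonDyer.BirchSwinnertonDyer.Theses.GenusKolyvaginAtTwo

/-- **The `𝔽₄`-structure of `H¹(K, E[2])` at the discriminant field, with a generic vector** — the
object whose construction refutes Q5 as typed. Data: a globally minimal non-CM `W/ℚ` with `Δ < 0`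
and `ρ_{W,2^n}` onto for all `n`; an imaginary quadratic `K` (in nature `ℚ(√Δ_W)`) with its
non-trivial automorphism `c`; an additive endomorphism `ω` of `H¹(K, E[2])` with `ω² + ω + 1 = 0`
(in nature: induced by the order-`3` element of `ρ̄_{W,2}(Γ_K) = A₃` acting on the coefficients),
`ω`-semilinearity of `c_*` (`c_* ∘ ω = ω² ∘ c_*`), `ω`-stability of every strict local kernel, and
a class `x` with `x, c_* x` independent over `𝔽₄ = 𝔽₂[ω]`. This is the CONSTRUCTION HYPOTHESIS of
the negative-modulo booking of item 24881 (the data of `DiscFieldFourStructureAtTwo`), not a published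
theorem: no cite tag, not a Literature fact. -/
structure DiscFieldFourStructureData where
  /-- The curve `E = W/ℚ`. -/
  W : WeierstrassCurve ℚ
  /-- `W` is an elliptic curve. -/
  [isElliptic : W.IsElliptic]
  /-- `W` is a globally minimal model. -/
  [isGloballyMinimal : W.IsGloballyMinimal]
  /-- The field `K` (in nature `ℚ(√Δ_W)`). -/
  K : Type
  /-- `K` is a field. -/
  [instField : Field K]
  /-- `K` is a number field. -/
  [instNumberField : NumberField K]
  /-- The non-trivial automorphism of `K`. -/
  c : K ≃ₐ[ℚ] K
  /-- The `𝔽₄`-structure: an endomorphism `ω` of `H¹(K, E[2])` with `ω² + ω + 1 = 0`. -/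
  ω : galH1Torsion (W.baseChange K) ((2 ^ 1 : ℕ) : ℤ) →+
    galH1Torsion (W.baseChange K) ((2 ^ 1 : ℕ) : ℤ)
  /-- The generic class `x`. -/
  x : galH1Torsion (W.baseChange K) ((2 ^ 1 : ℕ) : ℤ)
  /-- `W` has no complex multiplication. -/
  not_hasCM : ¬ W.HasCM
  /-- `Δ(W) < 0`. -/
  Δ_neg : W.Δ < 0
  /-- `K` is imaginary quadratic. -/
  isImaginaryQuadratic : IsImaginaryQuadratic K
  /-- `ρ_{W,2^n}` is onto for every `n`. -/
  surj : ∀ n : ℕ, W.HasSurjectiveModNGaloisRep (2 ^ n : ℕ)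
  /-- `c ≠ 1`. -/
  c_ne_one : c ≠ 1
  /-- `ω² + ω + 1 = 0` on `H¹(K, E[2])`. -/
  ω_sq_add : ∀ y, ω (ω y) + ω y + y = 0
  /-- `c_*` is `ω`-semilinear: `c_* (ω y) = ω² (c_* y)`. -/
  conjAct_ω : ∀ y, conjAct W c ((2 ^ 1 : ℕ) : ℤ) (ω y) = ω (ω (conjAct W c ((2 ^ 1 : ℕ) : ℤ) y))
  /-- Every strict local kernel `ker (H¹(K, E[2]) → H¹(K_v, E[2]))` is `ω`-stable. -/
  ω_mem : ∀ (v : HeightOneSpectrum (𝓞 K)) (y : galH1Torsion (W.baseChange K) ((2 ^ 1 : ℕ) : ℤ)),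
    y ∈ (W.baseChange K).torsionLocalKer (v.adicCompletion K) ((2 ^ 1 : ℕ) : ℤ) →
      ω y ∈ (W.baseChange K).torsionLocalKer (v.adicCompletion K) ((2 ^ 1 : ℕ) : ℤ)
  /-- `x, ωx, c_* x, ω c_* x` are `𝔽₂`-independent (`x, c_* x` are `𝔽₄`-independent). -/
  indep : ∀ a b d e : ℤ, a • x + b • ω x + d • conjAct W c ((2 ^ 1 : ℕ) : ℤ) x +
      e • ω (conjAct W c ((2 ^ 1 : ℕ) : ℤ) x) = 0 → (2 : ℤ) ∣ a ∧ (2 : ℤ) ∣ b ∧ (2 : ℤ) ∣ d ∧ (2 : ℤ) ∣ e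

/-- **`DiscFieldFourStructureAtTwo`**: some `(W, K)` in Q5's range carries the `𝔽₄`-structure of
`H¹(K, E[2])` with a generic vector (`DiscFieldFourStructureData`). True in nature at
`K = ℚ(√Δ_W)` for every `W` in Q5's range (module docstring); a construction item for the tree.
This is the hypothesis `H` of `equivariantChebotarevAtTwo_false_of_DiscFieldFourStructureAtTwo`
(negative-modulo booking of item 24881), not a published theorem: no cite tag, not a Literature fact. -/
def DiscFieldFourStructureAtTwo : Prop := Nonempty DiscFieldFourStructureData

set_option maxHeartbeats 800000 in
/-- **Q5 `EquivariantChebotarevAtTwo` as typed is false, modulo `DiscFieldFourStructureAtTwo`.**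
Given the structure at `(W, K, c, ω, x)`, the family `(ωx + ω²x^c, x, x^c)` with `π = (1 2)`,
`M = Mᵢ = 1`, `N = 1` satisfies all hypotheses of Q5, and the admissible prescription `Nv = (1, 0, 0)`
has NO prime: at the place `λ ∋ ℓ` the local kernel is `ω`-stable, so `x, x^c ∈ ker loc_λ` forces
`ωx + ω²x^c ∈ ker loc_λ`. [cite: McCallumLMS1991, §3 Cor. 3.2 (hypothesis K ⊄ ℚ(E_p) of §3)]
[cite: GrossLMS1991, §9 Prop. 9.1] -/
theorem equivariantChebotarevAtTwo_false_of_DiscFieldFourStructureAtTwo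
    (h : DiscFieldFourStructureAtTwo) : ¬ EquivariantChebotarevAtTwo := by
  obtain ⟨D⟩ := h
  obtain ⟨W, K, c, ω, x, hcm, hΔ, hK, hρ, hc, hω1, hω2, hω3, hgen⟩ := D
  intro hQ5
  -- ### basic identities (`L = 2^1` is the level of Q5 at `M = 1`)
  have hcc : c * c = 1 := mul_self_eq_one_of_isImaginaryQuadratic hK c
  have hττ : ∀ y : galH1Torsion (W.baseChange K) ((2 ^ 1 : ℕ) : ℤ),
      conjAct W c ((2 ^ 1 : ℕ) : ℤ) (conjAct W c ((2 ^ 1 : ℕ) : ℤ) y) = y :=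
    fun y ↦ conjAct_conjAct_of_mul_self W hcc _ y
  have hω3' : ∀ y, ω (ω (ω y)) = y := fun y ↦ by
    have h1 := hω1 y
    have h2 := hω1 (ω y)
    have h3 : ω (ω (ω y)) - y = (ω (ω (ω y)) + ω (ω y) + ω y) - (ω (ω y) + ω y + y) := by abel
    rw [h2, h1, sub_zero, sub_eq_zero] at h3
    exact h3
  have hωω : ∀ y, ω (ω y) = -(ω y) - y := fun y ↦ by
    rw [← sub_eq_zero, ← hω1 y]; abel
  have h2y : ∀ y : galH1Torsion (W.baseChange K) ((2 ^ 1 : ℕ) : ℤ), (2 : ℕ) • y = 0 := fun y ↦ by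
    have h2 := zsmul_galH1Torsion_eq_zero (W.baseChange K) ((2 ^ 1 : ℕ) : ℤ) y
    rw [natCast_zsmul] at h2
    exact h2
  haveI : Fact (Nat.Prime 2) := ⟨Nat.prime_two⟩
  -- ### the family `(c0, x, xτ)`, `xτ = c_* x`, `c0 = ωx + ω²xτ`
  have key : ∀ a₀ a₁ a₂ : ℤ,
      a₀ • (ω x + ω (ω (conjAct W c ((2 ^ 1 : ℕ) : ℤ) x))) + a₁ • x +
          a₂ • conjAct W c ((2 ^ 1 : ℕ) : ℤ) x =
        a₁ • x + a₀ • ω x + (a₂ - a₀) • conjAct W c ((2 ^ 1 : ℕ) : ℤ) x +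
          (-a₀) • ω (conjAct W c ((2 ^ 1 : ℕ) : ℤ) x) := fun a₀ a₁ a₂ ↦ by
    rw [hωω (conjAct W c ((2 ^ 1 : ℕ) : ℤ) x), zsmul_add, zsmul_sub, zsmul_neg, sub_zsmul, neg_zsmul]
    abel
  have hgen' : ∀ a₀ a₁ a₂ : ℤ,
      a₀ • (ω x + ω (ω (conjAct W c ((2 ^ 1 : ℕ) : ℤ) x))) + a₁ • x +
          a₂ • conjAct W c ((2 ^ 1 : ℕ) : ℤ) x = 0 →
      (2 : ℤ) ∣ a₀ ∧ (2 : ℤ) ∣ a₁ ∧ (2 : ℤ) ∣ a₂ := fun a₀ a₁ a₂ h ↦ by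
    rw [key] at h
    obtain ⟨h1, h0, h20, -⟩ := hgen a₁ a₀ (a₂ - a₀) (-a₀) h
    exact ⟨h0, h1, by simpa using dvd_add h20 h0⟩
  have hc0ne : ω x + ω (ω (conjAct W c ((2 ^ 1 : ℕ) : ℤ) x)) ≠ 0 := fun h ↦ by
    have h' := hgen' 1 0 0 (by rw [one_zsmul, zero_zsmul, zero_zsmul, add_zero, add_zero]; exact h)
    exact absurd h'.1 (by decide)
  have hxne : x ≠ 0 := fun h ↦ by
    have h' := hgen' 0 1 0 (by rw [one_zsmul, zero_zsmul, zero_zsmul, zero_add, add_zero]; exact h)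
    exact absurd h'.2.1 (by decide)
  have hxτne : conjAct W c ((2 ^ 1 : ℕ) : ℤ) x ≠ 0 := fun h ↦ by
    have h' := hgen' 0 0 1 (by rw [one_zsmul, zero_zsmul, zero_zsmul, zero_add, zero_add]; exact h)
    exact absurd h'.2.2 (by decide)
  let cs : Fin 3 → galH1Torsion (W.baseChange K) ((2 ^ 1 : ℕ) : ℤ) :=
    ![ω x + ω (ω (conjAct W c ((2 ^ 1 : ℕ) : ℤ) x)), x, conjAct W c ((2 ^ 1 : ℕ) : ℤ) x]
  let π : Fin 3 → Fin 3 := ![0, 2, 1]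
  let Mi : Fin 3 → ℕ := fun _ ↦ 1
  let Nv : Fin 3 → ℕ := ![1, 0, 0]
  have hcs0 : cs 0 = ω x + ω (ω (conjAct W c ((2 ^ 1 : ℕ) : ℤ) x)) := rfl
  have hcs1 : cs 1 = x := rfl
  have hcs2 : cs 2 = conjAct W c ((2 ^ 1 : ℕ) : ℤ) x := rfl
  have h0 : ∀ i, cs i ≠ 0 := by
    intro i; fin_cases i
    · exact hc0ne
    · exact hxne
    · exact hxτne
  have hord : ∀ i, addOrderOf (cs i) = 2 := fun i ↦
    (addOrderOf_eq_prime_iff).mpr ⟨h2y (cs i), h0 i⟩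
  have hMi : ∀ i, addOrderOf (cs i) = 2 ^ Mi i := fun i ↦ by rw [hord i]; rfl
  -- `τ`-stability
  have e2 : conjAct W c ((2 ^ 1 : ℕ) : ℤ) (ω (conjAct W c ((2 ^ 1 : ℕ) : ℤ) x)) = ω (ω x) := by
    rw [hω2, hττ]
  have e3 : conjAct W c ((2 ^ 1 : ℕ) : ℤ) (ω (ω (conjAct W c ((2 ^ 1 : ℕ) : ℤ) x))) = ω x := by
    rw [hω2, e2, hω3']
  have hτc0 : conjAct W c ((2 ^ 1 : ℕ) : ℤ) (ω x + ω (ω (conjAct W c ((2 ^ 1 : ℕ) : ℤ) x))) =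
      ω x + ω (ω (conjAct W c ((2 ^ 1 : ℕ) : ℤ) x)) := by
    rw [map_add, e3, hω2, add_comm]
  have hτs : ∀ i, conjAct W c ((2 ^ 1 : ℕ) : ℤ) (cs i) = cs (π i) := by
    intro i; fin_cases i
    · exact hτc0
    · rfl
    · exact hττ x
  -- independence
  have hind : ∀ a : Fin 3 → ℤ, ∑ i, a i • cs i = 0 → ∀ i, (addOrderOf (cs i) : ℤ) ∣ a i := by
    intro a ha i
    rw [Fin.sum_univ_three, hcs0, hcs1, hcs2] at ha
    obtain ⟨h0', h1', h2'⟩ := hgen' (a 0) (a 1) (a 2) ha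
    rw [hord i]
    fin_cases i
    · exact h0'
    · exact h1'
    · exact h2'
  -- restriction-injectivity (Gross 9.1 at `2`, every quadratic `K`)
  have hsurj : W.HasSurjectiveModNGaloisRep 2 := by simpa using hρ 1
  have hres : ∀ a : Fin 3 → ℤ, (∀ ρ ∈ torsionFixing (W.baseChange K) ((2 ^ 1 : ℕ) : ℤ),
      h1Eval (W.baseChange K) ((2 ^ 1 : ℕ) : ℤ) (∑ i, a i • cs i) ρ = 0) → ∑ i, a i • cs i = 0 :=
    fun a ha ↦ KolyvaginImageTwo.h1_restriction_injective_two W K hK.1 hsurj ha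
  have hNe : ∀ i, Nv i ≤ Mi i := by
    intro i; fin_cases i <;> decide
  have hNπ : ∀ i, Nv (π i) = Nv i := by
    intro i; fin_cases i <;> rfl
  -- ### Q5 at this family with the prescription `(1, 0, 0)`
  haveI : NeZero (1 : ℕ) := ⟨one_ne_zero⟩
  have hinf := hQ5 1 W hcm hΔ K hK hρ c hc 1 le_rfl 3 cs π h0 hτs hind hres Mi hMi Nv hNe hNπ
  obtain ⟨ℓ, hℓ⟩ := hinf.nonempty
  rw [Set.mem_setOf_eq] at hℓ
  obtain ⟨-, hKol, -, hloc⟩ := hℓ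
  -- the place `λ = (ℓ)` of `K`
  have hI : (Ideal.span {(ℓ : 𝓞 K)}).IsPrime := hKol.2.2.2.2.1
  have hne : Ideal.span {(ℓ : 𝓞 K)} ≠ ⊥ := by
    rw [Ne, Ideal.span_singleton_eq_bot]
    exact_mod_cast hKol.1.ne_zero
  let v : HeightOneSpectrum (𝓞 K) := ⟨Ideal.span {(ℓ : 𝓞 K)}, hI, hne⟩
  have hv : (ℓ : 𝓞 K) ∈ v.asIdeal := Ideal.mem_span_singleton_self _
  have h20 : ((2 ^ 0 : ℕ) : ℤ) = 1 := by norm_num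
  have hx1 : x ∈ (W.baseChange K).torsionLocalKer (v.adicCompletion K) ((2 ^ 1 : ℕ) : ℤ) := by
    have h1 := (hloc 1 v hv 0).mpr (le_refl _)
    rw [h20, one_zsmul] at h1
    exact h1
  have hx2 : conjAct W c ((2 ^ 1 : ℕ) : ℤ) x ∈
      (W.baseChange K).torsionLocalKer (v.adicCompletion K) ((2 ^ 1 : ℕ) : ℤ) := by
    have h1 := (hloc 2 v hv 0).mpr (le_refl _)
    rw [h20, one_zsmul] at h1
    exact h1
  have hx0 : ω x + ω (ω (conjAct W c ((2 ^ 1 : ℕ) : ℤ) x)) ∉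
      (W.baseChange K).torsionLocalKer (v.adicCompletion K) ((2 ^ 1 : ℕ) : ℤ) := by
    intro hmem
    have h1 := (hloc 0 v hv 0).mp (by rw [h20, one_zsmul]; exact hmem)
    exact absurd h1 (by decide)
  exact hx0 (add_mem (hω3 v x hx1) (hω3 v _ (hω3 v _ hx2)))

end Summit.BirchSwinnertonDyer.BirchSwinnertonDyer.Theorems.GenusExact

end
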